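import Mathlib

/-!
# Tier 4 — Literature: the local ε-dichotomy for toric periods (Saito–Tunnell) and Waldspurger's global criterion, typed as printed (seat t4-lit-1)

Blind re-derivation cell `pub-hodge-repro`, Tier-4 literature seat `t4-lit-1` (README §9–§10).  Target tree path
`lean/Summits/Ventures/HodgeRepro/Tier4/LitToricLocal.lean`; HOME copy `lit/t4/LitToricLocal.lean`; deposit rows
`proofs/t4/inputs/t4-lit-1.md` I-t4-lit-1-25 … 27.

WHAT THIS FILE IS.  Line L1 (t4-plan-1, STATUS S11892 / S11915) consumes at its finite places `v ∈ S` the existence of an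
«admissible `τ_v`» — a local representation carrying both toric functionals — which the printed literature decides by
the ε-DICHOTOMY of Tunnell (Amer. J. Math. 105 (1983)) and Saito (Compositio 85 (1993)): a character `Ω` of `L^×`
(`L/k_u` quadratic) appears in an infinite-dimensional irreducible `π` of `GL₂(k_u)` iff `ε(Π ⊗ Ω^{-1}, ψ) = 1`, with
multiplicity at most one, and for discrete-series `π` in EXACTLY ONE of `π` and its Jacquet–Langlands partner `π′` on
`D_u^×`.  The primary prints are WANTED (W37 / W38, STATUS S11910 / S11912); the HELD statement is the restatement
D. Prasad, *Relating invariant linear form and local epsilon factors via global methods* (arXiv:math/0512151, the author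
copy of the Duke Math. J. article; store key `paper:arxiv-math_0512151`), §2 — quoted VERBATIM below — together with
Jacquet's trivial-character form (Ann. Sci. ENS 19 (1986) §6, NUMDAM print `paper:doi-10-24033-asens-1506`).  Part II types
Waldspurger's GLOBAL toric-period criterion on a quaternion algebra as Prasad restates it (his Theorem 3), the `D^×`-twin of
the unitary-group statement the tree already carries (`PeriodCloser.Borade2025_Thm1_4`).

Every object is a PARAMETER of an abstract vocabulary (`ToricLocalVocab`, `ToricGlobalVocab`): representations, characters,
the «appears» predicate, multiplicities, the ε-sign, the Jacquet–Langlands partner — nothing is constructed on Mathlib.  Each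
printed theorem is ONE `def … : Prop` whose premises are the theorem's hypotheses; NO published theorem is proved.  A Tier-4
line that relies on one displays it as a hypothesis of a LEMMA (never of `P_T4`) and `proofs/t4/INPUTS.md` rows it.

Nothing here says anything about the status of the Hodge conjecture for CM abelian varieties, which is NOT proved; HC_CM is
NOT proved by anyone in this repository.
-/

set_option autoImplicit false

noncomputable section

namespace Summit.Ventures.HodgeRepro.Tier4.Lit

/-! ## Part I — the local vocabulary at one place `u` of `k`, `L/k_u` a quadratic extension -/

/-- **The local toric vocabulary** (Prasad §2 p0006:L3–L19; Jacquet §6 p0021:L59–p0022:L20): at a place `u` of the number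
field `k` with `L = F ⊗ k_u` a quadratic extension (a field), the irreducible admissible INFINITE-dimensional
representations `π` of `GL₂(k_u)`, the irreducible representations `π′` of `D_u^×` (`D_u` the quaternion division algebra),
the characters `Ω` of `L^×`, the characters of `k_u^×`, central characters and restriction, the predicate «`Ω` appears in
`π`» (`Hom_{L^×}(π, Ω) ≠ 0`), the multiplicity `dim Hom_{L^×}(π, Ω)`, the discrete series and the Jacquet–Langlands
partner, and the ε-sign `ε(Π ⊗ Ω^{-1}, ψ)` (Prasad Thm 4: independent of `ψ` trivial on `k_u`, `= ±1`; typed as a unit of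
`ℤ`).  Every field is a parameter. -/
structure ToricLocalVocab where
  /-- infinite-dimensional irreducible admissible representations of `GL₂(k_u)` -/
  Rep : Type
  /-- irreducible representations of `D_u^×` -/
  RepD : Type
  /-- characters of `L^×` -/
  Char : Type
  /-- characters of `k_u^×` -/
  CharK : Type
  /-- the central character of `π` -/
  centralChar : Rep → CharK
  /-- the central character of `π′` -/
  centralCharD : RepD → CharK
  /-- restriction of a character of `L^×` to `k_u^×` -/
  restrict : Char → CharK
  /-- `dim Hom_{L^×}(π, Ω)` -/
  mult : Char → Rep → ℕ
  /-- `dim Hom_{L^×}(π′, Ω)` -/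
  multD : Char → RepD → ℕ
  /-- `π` is in the discrete series -/
  IsDiscreteSeries : Rep → Prop
  /-- the Jacquet–Langlands partner `π′` of a discrete-series `π` («the corresponding finite dimensional irreducible
  representation of `D_u^×`», Prasad p0006:L14–L15); a parameter, meaningful on `IsDiscreteSeries` only -/
  jl : Rep → RepD
  /-- `ε(Π ⊗ Ω^{-1}, ψ) ∈ {±1}`, `Π` the base change of `π` to `GL₂(L)` (Prasad Thm 4, p0006:L64–L71) -/
  eps : Rep → Char → ℤˣ

namespace ToricLocalVocab

variable (V : ToricLocalVocab)

/-- «`Ω` appears in `π`»: `Hom_{L^×}(π, Ω) ≠ 0`, i.e. positive multiplicity. -/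
def Appears (Ω : V.Char) (π : V.Rep) : Prop := 0 < V.mult Ω π

/-- «`Ω` appears in `π′`» on the quaternion side. -/
def AppearsD (Ω : V.Char) (π' : V.RepD) : Prop := 0 < V.multD Ω π'

end ToricLocalVocab

/-- **PRINTED — multiplicity at most one** (Prasad §2 p0006:L10–L12, VERBATIM: «It is elementary to see that characters of
`L^*` appear with multiplicity at most 1 in any irreducible representation of `GL_2(k_u)`, or of `D_u^*`; see for example,
remark 3.5 of [P1].»; Jacquet §6 (6.1) p0021:L63–p0022:L8, VERBATIM: «Soit `π` une représentation unitaire irréductible de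
`G_i/Z_i`.  Alors la dimension de l'espace des formes linéaires continues et `T_i`-invariantes sur l'espace des vecteurs
lisses de `π` est au plus un.» — «Si `F` n'est pas archimédien alors l'assertion sur la dimension est prouvée dans [W2],
Propositions 9.»).  Typed as: every multiplicity is `≤ 1`, on both sides. -/
def MultiplicityLeOne (V : ToricLocalVocab) : Prop :=
  (∀ (Ω : V.Char) (π : V.Rep), V.mult Ω π ≤ 1) ∧ (∀ (Ω : V.Char) (π' : V.RepD), V.multD Ω π' ≤ 1)

/-- **PRINTED — Saito–Tunnell, as restated by Prasad, Theorem 4** (`paper:arxiv-math_0512151` p0006:L61–L74, VERBATIM):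
«Theorem 4. (Saito, Tunnell) Let `π` be an infinite dimensional irreducible admissible representation of `GL_2(k_u)`, `L` a
quadratic extension of `k_u`, and `Π` the base change lift of `π` to `GL_2(L)`.  Fix a nontrivial additive character `ψ` of
`L` which restricted to `k` is trivial.  Then for a character `Ω_u` of `L^*` which has the same restriction to `k_u^*` as the
central character of `π`, `ε(Π ⊗ Ω_u^{-1}, ψ)` is indepenent [sic] of `ψ` (as long as its restriction to `k_u` is trivial),
and takes the value `±1`.  The character `Ω_u` of `L^*` appears in `π` if and only if `ε(Π ⊗ Ω_u^{-1}, ψ) = 1`.»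
PRIMARY PRINTS WANTED: Tunnell, Amer. J. Math. 105 (1983) 1277–1307 (W37); Saito, Compositio Math. 85 (1993) 99–108 (W38).
Prasad p0006:L57–L59: «although not stated in their papers for Archimedean fields [the theorem] is valid for such fields
too».  Typed as: for `Ω` with `restrict Ω = centralChar π`, `Ω` appears in `π` iff `eps π Ω = 1` (the `ψ`-independence is
built into the parameter `eps`). -/
def SaitoTunnell_appears_iff_eps (V : ToricLocalVocab) : Prop :=
  ∀ (π : V.Rep) (Ω : V.Char), V.restrict Ω = V.centralChar π → (V.Appears Ω π ↔ V.eps π Ω = 1)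

/-- **PRINTED — the dichotomy** (Prasad §2 p0006:L12–L19, VERBATIM: «The dichotomy principle too holds in this situation,
i.e., if `π` is a discrete series representation of `GL_2(k)`, and `π'` is the corresponding finite dimensional irreducible
representation of `D_u^*`, then for a character `χ` of `L^*` whose restriction to `k_u^*` is the same as the central
character of `π`, `χ` appears in exactly one of the representations `π` or `π'`.  This follows from the character identity
`Θ_π(x) = −Θ_{π'}(x)`.»; Jacquet §6 (6.3) p0022:L14–L20 for the trivial character: «Les représentations `π_i` ne peuvent
toutes les deux avoir un vecteur non nul invariant sous le groupe `T_i`.  Si `F` est non archimédien alors notre assertion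
se trouve dans le théorème 2 de [W2].»).  Typed as `Xor`: exactly one of «`χ` appears in `π`», «`χ` appears in `jl π`». -/
def SaitoTunnell_dichotomy (V : ToricLocalVocab) : Prop :=
  ∀ (π : V.Rep) (χ : V.Char), V.IsDiscreteSeries π → V.restrict χ = V.centralChar π →
    Xor (V.Appears χ π) (V.AppearsD χ (V.jl π))

/-- The elementary consequence a line draws (set theory / logic only, PROVED): under the dichotomy, for a discrete-series
`π` and a compatible `χ`, SOME representation — `π` itself or its partner — carries `χ`: the «an admissible `τ_v` exists»
reading of L1.5, stated on the two sides. -/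
theorem exists_side_appears_of_dichotomy (V : ToricLocalVocab) (h : SaitoTunnell_dichotomy V)
    (π : V.Rep) (χ : V.Char) (hπ : V.IsDiscreteSeries π) (hχ : V.restrict χ = V.centralChar π) :
    V.Appears χ π ∨ V.AppearsD χ (V.jl π) := by
  rcases h π χ hπ hχ with ⟨h1, _⟩ | ⟨h2, _⟩
  · exact Or.inl h1
  · exact Or.inr h2

/-- Under multiplicity `≤ 1`, «appears» is «multiplicity exactly one» (PROVED, arithmetic only). -/
theorem appears_iff_mult_eq_one (V : ToricLocalVocab) (h : MultiplicityLeOne V) (Ω : V.Char) (π : V.Rep) :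
    V.Appears Ω π ↔ V.mult Ω π = 1 := by
  unfold ToricLocalVocab.Appears
  have := h.1 Ω π
  omega

/-! ## Part II — Waldspurger's global criterion on a quaternion algebra (Prasad's Theorem 3) -/

/-- **The global toric vocabulary** (Prasad Thm 3 p0006:L26–L46): `k` a number field, `F/k` quadratic, `D` a quaternion
division algebra over `k` containing `F`, `T = F^× ⊂ D^×` the torus, `π′` an automorphic representation of `D(𝔸)^×`,
`Ω = ⊗ Ω_v` a continuous character of `T(k)\T(𝔸_k)`; the places of `k`; the predicate «`π′_v` has an `Ω_v`-invariant
linear form for the torus `(F ⊗ k_v)^×`»; the central value `L(½, Π ⊗ Ω^{-1})` of the base change `Π` of `π` to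
`GL₂(𝔸_F)`; the predicate «some `e′` in the space of `π′` has non-zero toric period `∫ e′(t) Ω^{-1}(t) dt`».  Parameters. -/
structure ToricGlobalVocab where
  /-- the places of `k` -/
  Place : Type
  /-- automorphic representations `π′` of `D(𝔸)^×` (realised on spaces of functions on `D^×\D(𝔸_k)^×`) -/
  AutRep : Type
  /-- continuous characters `Ω` of `T(k)\T(𝔸_k)` -/
  Char : Type
  /-- characters of the centre `𝔸_k^×` -/
  CentralChar : Type
  /-- the central character of `π′` -/
  centralChar : AutRep → CentralChar
  /-- the restriction of `Ω` to the centre -/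
  restrictCentre : Char → CentralChar
  /-- «the local representation `π′_v` has `Ω_v`-invariant linear form for the torus `(F ⊗ k_v)^×`» -/
  LocalInvariantForm : Place → AutRep → Char → Prop
  /-- `L(½, Π ⊗ Ω^{-1})`, `Π` the base change of `π` (the Jacquet–Langlands transfer of `π′`) to `GL₂(𝔸_F)` -/
  centralValueBC : AutRep → Char → ℂ
  /-- «there exists a function `e′` in `E′` such that `∫_{T(k)𝔸_k^×\T(𝔸_k)} e′(t) Ω^{-1}(t) dt` is nonzero» -/
  ToricPeriodNonzero : AutRep → Char → Prop

/-- **PRINTED — Waldspurger's criterion, as restated by Prasad, Theorem 3** (`paper:arxiv-math_0512151` p0006:L26–L46,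
VERBATIM): «Theorem 3. (Waldspurger) Let `k` be a number field, `F` a quadratic extension of `k`, `D` a quaternion division
algebra over `k` containing `F`, and `π'` an automorphic form on `D(𝔸)^*` realised on a space of functions `E'` on
`D^*\D(𝔸_k)^*`.  Let `T` be the torus inside `D^*` defined by `F`, and `Ω = ⊗ Ω_v` a continuous character of
`T(k)\T(𝔸_k)` whose restriction to the center of `D(𝔸)^*` is the same as the central character of `π'`.  Then there exists
a function `e'` in `E'` such that the integral `∫_{T(k)𝔸_k^*\T(𝔸_k)} e'(t) Ω^{-1}(t) dt` is nonzero if and only if the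
following two conditions are verified: • For all places `v` of `k`, the local representation `π'_v` has `Ω_v`-invariant
linear form for the torus `(F ⊗ k_v)^*`.  • If `Π` denotes the base change of `π` to `GL_2(𝔸_F)`, `L(½, Π ⊗ Ω^{-1}) ≠ 0`.»
The PRIMARY print (Waldspurger, Compositio Math. 54 (1985) 173–242) is not held; this is the restatement.  Typed with the
central-character compatibility as premise. -/
def Waldspurger1985_toricPeriod_iff (W : ToricGlobalVocab) : Prop :=
  ∀ (π' : W.AutRep) (Ω : W.Char), W.restrictCentre Ω = W.centralChar π' →
    (W.ToricPeriodNonzero π' Ω ↔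
      ((∀ v : W.Place, W.LocalInvariantForm v π' Ω) ∧ W.centralValueBC π' Ω ≠ 0))

end Summit.Ventures.HodgeRepro.Tier4.Lit
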